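import Literature.Analysis.FluidPDE.Ferrari1993EnergyInequalityReduction
import Literature.Analysis.FluidPDE.PeriodicCylinderGagliardoNirenberg
import Literature.Analysis.FunctionSpaces.SobolevDomainGNSProofs
import HarnessLib

/-!
# Term bounds for the commutator estimate of Ferrari 1993, Lemma 1 (ii), on the period cell

Topic `Literature/Analysis/FluidPDE`. Analytic lemmas for the discharge of the named fact
`Literature.Analysis.FluidPDE.Ferrari1993_periodicCylinderCommutatorEstimate`
(`Ferrari1993EnergyInequalityReduction.lean`; A. B. Ferrari, Comm. Math. Phys. **155** (1993),
Lemma 1 (ii) and the display following it, p. 280: `|u·D^α∇u − D^α(u·∇u)|_{L²} ≤ C |u|_{H^s} |u|_{W^{1,∞}}`,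
`|α| ≤ s = 3`). Unrolling the Leibniz recursion of the word commutator
(`ConvectCommutatorCalculus.lean`) for words of length `≤ 3`, the commutator `[D_w, v·∇]v` is a
sum of convective products `(D_β v·∇) D_γ v` of three kinds, bounded here in `L²(cell)` for a
velocity field `v` smooth on the closed cylinder and `L`-periodic:

* type I (`|β| = 1`): `‖(∂ₐv·∇) B‖_{L²} ≤ C ‖∂ₐv‖_∞ Σⱼ ‖∂ⱼ B‖_{L²}` (`eLpNorm_convect_le_of_norm_le`);
* type III (`γ = ∅`): `‖(A·∇) v‖_{L²} ≤ C (maxⱼ ‖∂ⱼv‖_∞) ‖A‖_{L²}` (`eLpNorm_convect_le_of_fderiv_apply_le`);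
* type II (`|β| = 2`, `|γ| = 1`): `‖(∂_b∂ₐv·∇) ∂_c v‖_{L²} ≤ K n n₃`
  (`exists_integral_norm_sq_convect_two_one_le`, stated in the two real currencies of the
  discharge: `n ≥ sup_cell ‖∂ⱼ v‖` for all `j` — read off `‖v‖_{W^{1,∞}(cell)}` — and
  `n₃² ≥ ∫_cell ‖D_w v‖²` for all words `|w| ≤ 3` — read off `‖v‖_{H³(cell)}`), through
  `‖fg‖_{L²} ≤ ‖f‖_{L⁴} ‖g‖_{L⁴}` and the Nirenberg `L⁴` inequality on the cell
  (`exists_integral_norm_fderiv_pow_four_le'`, `PeriodicCylinderGagliardoNirenberg.lean`: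
  `‖∂∂v‖²_{L⁴} ≤ C ‖∂v‖_∞ ‖v‖_{H³}`).

Currency conversions recorded: pointwise bounds from the `L^∞(cell)` norm for functions continuous
on the open cell (`norm_le_of_eLpNorm_top_of_continuousOn`), their extension to the closed cylinder
by continuity and periodicity (`norm_le_of_forall_mem_cylinderCell`, via
`subset_closure_cylinderCell`), the `L²(cell)` norm of a word derivative against the tree's
`H³(cell)` norm (`eLpNorm_iterDeriv_le_eSobolevDomainNorm`, word expansion
`eSobolevDomainNorm_eq_sum_iterDeriv`), and `iterDeriv_snoc` (differentiating a word derivative once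
more appends a letter). All statements are folklore calculus given the cited inequality.

## Mathlib / tree search

Word derivatives *within* the closed cylinder already exist in two forms in the tree:
`cylDeriv` / `cylWord` (`PeriodicCylinderWithinCalculus.lean`: `List`-indexed words of letters,
with `contDiffOn_cylWord`, `cylDeriv_eq_fderiv`, `IsAxiallyPeriodic.cylWord`) and, for time-dependent
fields, `jointIterDeriv` (`IteratedSliceDerivatives.lean`, spatial components of the joint
derivative). The `iterDerivWithin K m u f` of this file is nevertheless kept separate and generic
(any set `K`; `Fin m`-indexed words applied in the order `u 0` first, i.e. *exactly* the indexing
and letter order of `iterDeriv`), so that `iterDerivWithin_eqOn_iterDeriv` feeds the word expansion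
`eSobolevDomainNorm_eq_sum_iterDeriv` of the tree's Sobolev norm without re-indexing, and without
that file's imports; a librarian may later express one through the other. Pointwise values against
the `L^∞` norm: `FunctionSpaces.enorm_le_eLpNorm_top_of_continuous` (`SobolevDomainProofs.lean`,
globally continuous `f`, open-positive measure) and `enorm_le_eLpNormEssSup_of_continuous`
(`SobolevTracePoincareProofs.lean`, restriction to an open set but globally continuous `f`) — here
`f` is continuous on the open set only (`iterDeriv` is junk off it), whence the variant
`enorm_le_eLpNorm_top_of_continuousOn`. Closure of the cell: `mem_closure_cylinderCell`
(`PeriodicCylinderSobolevHolder.lean`, points with `r < 1`) — here `r ≤ 1` is needed (the wall), whence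
`subset_closure_cylinderCell`. `tail_snoc_eq_snoc_tail` / `iterDeriv_snoc`: no Mathlib counterpart.
-/

noncomputable section

open MeasureTheory Set Function Filter Topology TopologicalSpace WithLp Real
open scoped ContDiff NNReal ENNReal InnerProductSpace RealInnerProductSpace

namespace Literature.Analysis.FluidPDE

open Literature.Analysis.FunctionSpaces

/-- Abbreviation inside this file: the dimension index of the tree's basis of `ℝ³`. -/
local notation "𝔡" => Module.finrank ℝ (EuclideanSpace ℝ (Fin 3))
/-- Abbreviation inside this file: the tree's basis of `ℝ³`. -/
local notation "𝔢" => Module.finBasis ℝ (EuclideanSpace ℝ (Fin 3))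

/-! ### Pointwise values against the `L^∞` norm, for continuous functions on an open set -/

section EssSup

variable {F' : Type*} [NormedAddCommGroup F']

/-- **A continuous function is bounded pointwise by its `L^∞` norm on an open set** (Lebesgue
measure charges nonempty open sets): `‖f x‖ₑ ≤ ‖f‖_{L^∞(U)}` for `x ∈ U`. Variant of the tree's
`FunctionSpaces.enorm_le_eLpNorm_top_of_continuous` (globally continuous `f`) and
`enorm_le_eLpNormEssSup_of_continuous` for functions continuous **on the open set only**. [folklore] -/
theorem enorm_le_eLpNorm_top_of_continuousOn {U : Set (EuclideanSpace ℝ (Fin 3))} (hU : IsOpen U)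
    {f : EuclideanSpace ℝ (Fin 3) → F'} (hf : ContinuousOn f U) {x : EuclideanSpace ℝ (Fin 3)}
    (hx : x ∈ U) : ‖f x‖ₑ ≤ eLpNorm f ∞ (volume.restrict U) := by
  by_contra h
  push Not at h
  set c := eLpNorm f ∞ (volume.restrict U) with hc
  have hopen : IsOpen (U ∩ f ⁻¹' {z | c < ‖z‖ₑ}) :=
    hf.isOpen_inter_preimage hU (isOpen_lt continuous_const continuous_enorm)
  have hxS : x ∈ U ∩ f ⁻¹' {z | c < ‖z‖ₑ} := ⟨hx, h⟩
  have hpos : 0 < volume (U ∩ f ⁻¹' {z | c < ‖z‖ₑ}) := hopen.measure_pos volume ⟨x, hxS⟩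
  have hae : ∀ᵐ y ∂(volume.restrict U), ‖f y‖ₑ ≤ c := by
    rw [hc, eLpNorm_exponent_top]; exact ae_le_eLpNormEssSup
  have hnull : volume.restrict U {y | c < ‖f y‖ₑ} = 0 := by
    rw [ae_iff] at hae
    simpa only [not_le] using hae
  rw [Measure.restrict_apply' hU.measurableSet, inter_comm] at hnull
  exact hpos.ne' hnull

/-- Real form: if `‖f‖_{L^∞(U)} ≤ N < ∞` then `‖f x‖ ≤ N.toReal` on `U`. [folklore] -/
theorem norm_le_of_eLpNorm_top_of_continuousOn {U : Set (EuclideanSpace ℝ (Fin 3))} (hU : IsOpen U)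
    {f : EuclideanSpace ℝ (Fin 3) → F'} (hf : ContinuousOn f U) {N : ℝ≥0∞} (hN : N ≠ ⊤)
    (hfN : eLpNorm f ∞ (volume.restrict U) ≤ N) {x : EuclideanSpace ℝ (Fin 3)} (hx : x ∈ U) :
    ‖f x‖ ≤ N.toReal := by
  have h := (enorm_le_eLpNorm_top_of_continuousOn hU hf hx).trans hfN
  rw [← ofReal_norm] at h
  exact (ENNReal.ofReal_le_iff_le_toReal hN).1 h

end EssSup

/-! ### From the open cell to the closed cylinder: closure and periodicity -/

/-- Functions with the same first two coordinates have the same cylindrical radius. [folklore] -/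
theorem cylRadius_congr {x y : EuclideanSpace ℝ (Fin 3)} (h0 : x 0 = y 0) (h1 : x 1 = y 1) :
    cylRadius x = cylRadius y := by
  simp only [cylRadius, h0, h1]

/-- **The closed period cell**: every point with `r ≤ 1` and `0 ≤ z ≤ L` is in the closure of the
open cell `{r < 1} × (0, L)` (`L > 0`): it is the endpoint of the segment from the interior point
`(0, 0, L/2)`, whose other points lie in the cell. (The tree's `mem_closure_cylinderCell`,
`PeriodicCylinderSobolevHolder.lean`, covers points with `r < 1`; the wall `r = 1` is needed here.)
[folklore] -/
theorem subset_closure_cylinderCell {L : ℝ} (hL : 0 < L) :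
    {x : EuclideanSpace ℝ (Fin 3) | cylRadius x ≤ 1 ∧ x 2 ∈ Icc 0 L} ⊆
      closure (cylinderCell L : Set (EuclideanSpace ℝ (Fin 3))) := by
  rintro x ⟨hr, hz⟩
  set c : EuclideanSpace ℝ (Fin 3) := (L / 2) • EuclideanSpace.single (2 : Fin 3) (1 : ℝ) with hc
  set p : ℝ → EuclideanSpace ℝ (Fin 3) := fun t => c + t • (x - c) with hp
  have hp1 : p 1 = x := by simp [hp]
  have hcont : Continuous p := by fun_prop
  have hmem : ∀ t ∈ Ioo (0 : ℝ) 1, p t ∈ (cylinderCell L : Set (EuclideanSpace ℝ (Fin 3))) := by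
    intro t ht
    have hc0 : c 0 = 0 := by simp [hc]
    have hc1 : c 1 = 0 := by simp [hc]
    have hc2 : c 2 = L / 2 := by simp [hc]
    have hp0 : p t 0 = (t • x) 0 := by simp [hp, hc0]
    have hp1' : p t 1 = (t • x) 1 := by simp [hp, hc1]
    have hp2 : p t 2 = L / 2 + t * (x 2 - L / 2) := by simp [hp, hc2]
    rw [SetLike.mem_coe, mem_cylinderCell, cylRadius_congr hp0 hp1', cylRadius_smul, abs_of_pos ht.1,
      hp2]
    refine ⟨?_, ?_, ?_⟩
    · calc t * cylRadius x ≤ t * 1 := mul_le_mul_of_nonneg_left hr ht.1.le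
        _ < 1 := by rw [mul_one]; exact ht.2
    · nlinarith [hz.1, hz.2, ht.1, ht.2]
    · nlinarith [hz.1, hz.2, ht.1, ht.2]
  have htend : Tendsto p (𝓝[<] (1 : ℝ)) (𝓝 x) := by
    rw [← hp1]; exact (hcont.tendsto 1).mono_left nhdsWithin_le_nhds
  refine mem_closure_of_tendsto htend ?_
  filter_upwards [Ioo_mem_nhdsLT (zero_lt_one' ℝ)] with t ht using hmem t ht

/-- **Sup bounds pass from the open cell to the closed cylinder** for a function continuous on the
closed cylinder and `L`-periodic (`L > 0`): by continuity to the closed cell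
`{r ≤ 1} × [0, L]`, then by periodicity to `{r ≤ 1} × ℝ`. [folklore] -/
theorem norm_le_of_forall_mem_cylinderCell {F' : Type*} [NormedAddCommGroup F'] {L : ℝ} (hL : 0 < L)
    {g : EuclideanSpace ℝ (Fin 3) → F'}
    (hg : ContinuousOn g (closure (unitCylinder : Set (EuclideanSpace ℝ (Fin 3)))))
    (hper : IsAxiallyPeriodic L g) {M : ℝ}
    (hM : ∀ x ∈ (cylinderCell L : Set (EuclideanSpace ℝ (Fin 3))), ‖g x‖ ≤ M) :
    ∀ x ∈ closure (unitCylinder : Set (EuclideanSpace ℝ (Fin 3))), ‖g x‖ ≤ M := by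
  -- (i) the closed cell
  have hclosed : ∀ y ∈ closure (cylinderCell L : Set (EuclideanSpace ℝ (Fin 3))), ‖g y‖ ≤ M := by
    intro y hy
    have hyK : y ∈ closure (unitCylinder : Set (EuclideanSpace ℝ (Fin 3))) :=
      closure_cylinderCell_subset L hy
    have hcw : ContinuousWithinAt g (cylinderCell L : Set (EuclideanSpace ℝ (Fin 3))) y :=
      (hg y hyK).mono (subset_closure.trans (closure_cylinderCell_subset L))
    have himg : g y ∈ closure (g '' (cylinderCell L : Set (EuclideanSpace ℝ (Fin 3)))) :=
      hcw.mem_closure_image hy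
    have hsub : g '' (cylinderCell L : Set (EuclideanSpace ℝ (Fin 3))) ⊆ Metric.closedBall 0 M := by
      rintro _ ⟨z, hz, rfl⟩
      exact mem_closedBall_zero_iff.2 (hM z hz)
    have := (closure_mono hsub) himg
    rw [Metric.isClosed_closedBall.closure_eq, mem_closedBall_zero_iff] at this
    exact this
  -- (ii) periodicity
  intro x hx
  set k : ℤ := ⌊x 2 / L⌋ with hk
  set x' : EuclideanSpace ℝ (Fin 3) := x + (((-k : ℤ) : ℝ) * L) • EuclideanSpace.single (2 : Fin 3) (1 : ℝ)
    with hx'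
  have hgx : g x' = g x := hper.add_int_mul (-k) x
  have hx'K : x' ∈ closure (unitCylinder : Set (EuclideanSpace ℝ (Fin 3))) :=
    (add_axialShift_mem_closure_unitCylinder_iff _).2 hx
  have hr : cylRadius x' ≤ 1 := by
    have := hx'K; rw [closure_unitCylinder] at this; exact this
  have hz : x' 2 ∈ Icc 0 L := by
    have h1 : (k : ℝ) ≤ x 2 / L := Int.floor_le _
    have h2 : x 2 / L < k + 1 := Int.lt_floor_add_one _
    have e : x' 2 = x 2 - k * L := by
      simp [hx']; ring
    rw [e]
    rw [le_div_iff₀ hL] at h1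
    rw [div_lt_iff₀ hL] at h2
    constructor <;> nlinarith
  rw [← hgx]
  exact hclosed x' (subset_closure_cylinderCell hL ⟨hr, hz⟩)

/-! ### Words: appending a letter -/

section Words

variable {E : Type*} [NormedAddCommGroup E] [NormedSpace ℝ E]
variable {F' : Type*} [NormedAddCommGroup F'] [NormedSpace ℝ F']

omit [NormedAddCommGroup E] [NormedSpace ℝ E] in
/-- `tail (snoc u a) = snoc (tail u) a`. [folklore] -/
theorem tail_snoc_eq_snoc_tail {n : ℕ} (u : Fin (n + 1) → E) (a : E) :
    Fin.tail (Fin.snoc u a : Fin (n + 2) → E) = Fin.snoc (Fin.tail u) a := by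
  funext j
  show (Fin.snoc u a : Fin (n + 2) → E) j.succ = (Fin.snoc (Fin.tail u) a : Fin (n + 1) → E) j
  by_cases hj : j = Fin.last n
  · subst hj
    rw [Fin.succ_last, Fin.snoc_last, Fin.snoc_last]
  · obtain ⟨i, rfl⟩ := Fin.exists_castSucc_eq.2 hj
    rw [Fin.succ_castSucc, Fin.snoc_castSucc, Fin.snoc_castSucc]
    rfl

/-- **Differentiating a word derivative once more appends a letter**:
`D_{(u, a)} f = ∂ₐ (D_u f)` for the word `snoc u a` (everywhere, by the recursion defining
`iterDeriv`). [folklore] -/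
theorem iterDeriv_snoc : ∀ (n : ℕ) (u : Fin n → E) (a : E) (f : E → F'),
    iterDeriv (n + 1) (Fin.snoc u a) f = fun x => fderiv ℝ (iterDeriv n u f) x a
  | 0, u, a, f => by
    rw [iterDeriv_succ, iterDeriv_zero, iterDeriv_zero]
    have : (Fin.snoc u a : Fin 1 → E) 0 = a := Fin.snoc_last (α := fun _ => E) a u
    simp only [this]
  | n + 1, u, a, f => by
    rw [iterDeriv_succ, tail_snoc_eq_snoc_tail, iterDeriv_snoc n (Fin.tail u) a,
      iterDeriv_succ]
    have h0 : (Fin.snoc u a : Fin (n + 2) → E) 0 = u 0 := Fin.snoc_apply_zero (α := fun _ => E) a u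
    simp only [h0]

end Words

/-! ### Word derivatives realised up to the boundary: `iterDerivWithin` -/

section Within

variable {E : Type*} [NormedAddCommGroup E] [NormedSpace ℝ E]
variable {F' : Type*} [NormedAddCommGroup F'] [NormedSpace ℝ F']

/-- **Word derivatives within a set**: `iterDerivWithin K m u f`, the analogue of `iterDeriv` with
`fderivWithin _ _ K` in place of `fderiv` (letters applied in the order `u 0` first). For `f` smooth
on a closed domain `K` of unique differentiability these are continuous up to the boundary and
agree with `iterDeriv m u f` in the interior (`iterDerivWithin_eqOn_iterDeriv`). Prior art in the
tree: `cylWord` (`PeriodicCylinderWithinCalculus.lean`, `List`-indexed, closed cylinder) and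
`jointIterDeriv` (`IteratedSliceDerivatives.lean`, time-dependent fields); this generic
`Fin`-indexed version keeps the indexing and letter order of `iterDeriv` (see the module doc).
[folklore] -/
def iterDerivWithin (K : Set E) : (m : ℕ) → (Fin m → E) → (E → F') → (E → F')
  | 0, _, f => f
  | m + 1, u, f => iterDerivWithin K m (Fin.tail u) (fun x => fderivWithin ℝ f K x (u 0))

/-- The empty word does nothing. [folklore] -/
@[simp]
theorem iterDerivWithin_zero (K : Set E) (u : Fin 0 → E) (f : E → F') : iterDerivWithin K 0 u f = f :=
  rfl

/-- One more letter: differentiate within `K` along `u 0` first. [folklore] -/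
theorem iterDerivWithin_succ (K : Set E) (m : ℕ) (u : Fin (m + 1) → E) (f : E → F') :
    iterDerivWithin K (m + 1) u f =
      iterDerivWithin K m (Fin.tail u) (fun x => fderivWithin ℝ f K x (u 0)) := rfl

/-- Appending a letter: `D^K_{(u,a)} f = ∂^K_a (D^K_u f)`. [folklore] -/
theorem iterDerivWithin_snoc (K : Set E) : ∀ (n : ℕ) (u : Fin n → E) (a : E) (f : E → F'),
    iterDerivWithin K (n + 1) (Fin.snoc u a) f = fun x => fderivWithin ℝ (iterDerivWithin K n u f) K x a
  | 0, u, a, f => by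
    rw [iterDerivWithin_succ, iterDerivWithin_zero, iterDerivWithin_zero]
    have : (Fin.snoc u a : Fin 1 → E) 0 = a := Fin.snoc_last (α := fun _ => E) a u
    simp only [this]
  | n + 1, u, a, f => by
    rw [iterDerivWithin_succ, tail_snoc_eq_snoc_tail, iterDerivWithin_snoc K n (Fin.tail u) a,
      iterDerivWithin_succ]
    have h0 : (Fin.snoc u a : Fin (n + 2) → E) 0 = u 0 := Fin.snoc_apply_zero (α := fun _ => E) a u
    simp only [h0]

/-- **Smoothness up to the boundary**: word derivatives within a set of unique differentiability
of a function `C^∞` there are `C^∞` there. [folklore] -/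
theorem contDiffOn_iterDerivWithin {K : Set E} (hK : UniqueDiffOn ℝ K) :
    ∀ (m : ℕ) (u : Fin m → E) {f : E → F'}, ContDiffOn ℝ ∞ f K →
      ContDiffOn ℝ ∞ (iterDerivWithin K m u f) K
  | 0, _, _, hf => hf
  | m + 1, u, _, hf => by
    rw [iterDerivWithin_succ]
    exact contDiffOn_iterDerivWithin hK m _
      ((hf.fderivWithin hK (by exact_mod_cast le_top)).clm_apply contDiffOn_const)

/-- **Interior agreement**: on an open set `U ⊆ K` at whose points `K` is a neighbourhood, the
word derivatives within `K` of a function `C^∞` on `K` are the classical ones. [folklore] -/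
theorem iterDerivWithin_eqOn_iterDeriv {K U : Set E} (hK : UniqueDiffOn ℝ K) (hU : IsOpen U)
    (hUK : ∀ x ∈ U, K ∈ 𝓝 x) :
    ∀ (m : ℕ) (u : Fin m → E) {f : E → F'}, ContDiffOn ℝ ∞ f K →
      EqOn (iterDerivWithin K m u f) (iterDeriv m u f) U
  | 0, _, _, _ => fun _ _ => rfl
  | m + 1, u, f, hf => by
    rw [iterDerivWithin_succ, iterDeriv_succ]
    have hf' : ContDiffOn ℝ ∞ (fun x => fderivWithin ℝ f K x (u 0)) K :=
      (hf.fderivWithin hK (by exact_mod_cast le_top)).clm_apply contDiffOn_const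
    have h1 : EqOn (fun x => fderivWithin ℝ f K x (u 0)) (fun x => fderiv ℝ f x (u 0)) U :=
      fun x hx => by simp only [fderivWithin_of_mem_nhds (hUK x hx)]
    exact (iterDerivWithin_eqOn_iterDeriv hK hU hUK m (Fin.tail u) hf').trans
      (iterDeriv_congr_of_isOpen hU m (Fin.tail u) h1)

end Within

/-- **Periodicity** of the word derivatives within the closed cylinder of a periodic function. [folklore] -/
theorem isAxiallyPeriodic_iterDerivWithin {F' : Type*} [NormedAddCommGroup F'] [NormedSpace ℝ F']
    {L : ℝ} : ∀ (m : ℕ) (u : Fin m → EuclideanSpace ℝ (Fin 3)) {f : EuclideanSpace ℝ (Fin 3) → F'},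
      IsAxiallyPeriodic L f →
      IsAxiallyPeriodic L (iterDerivWithin (closure (unitCylinder : Set (EuclideanSpace ℝ (Fin 3)))) m u f)
  | 0, _, _, hf => hf
  | m + 1, u, f, hf => by
    rw [iterDerivWithin_succ]
    refine isAxiallyPeriodic_iterDerivWithin m _ fun x => ?_
    have h := hf.fderivWithin_closure x
    dsimp only at h ⊢
    rw [h]

/-! ### The setting: a smooth periodic velocity field on the closed cylinder -/

section Setting


variable {L : ℝ} {v : EuclideanSpace ℝ (Fin 3) → EuclideanSpace ℝ (Fin 3)}

/-- **`L²(cell)` of a word derivative against `H³(cell)`**: for `v` smooth on the open cell and a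
word `w` of length `k ≤ 3` in the basis, `‖D_w v‖_{L²(cell)} ≤ ‖v‖_{H³(cell)}` (one term of the word
expansion `eSobolevDomainNorm_eq_sum_iterDeriv`). [folklore] -/
theorem eLpNorm_iterDeriv_le_eSobolevDomainNorm
    (hv : ContDiffOn ℝ ∞ v (cylinderCell L : Set (EuclideanSpace ℝ (Fin 3)))) {k : ℕ} (hk : k ≤ 3)
    (w : Fin k → Fin 𝔡) :
    eLpNorm (iterDeriv k (fun j => Module.finBasis ℝ (EuclideanSpace ℝ (Fin 3)) (w j)) v) 2
        (volume.restrict (cylinderCell L : Set (EuclideanSpace ℝ (Fin 3)))) ≤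
      eSobolevDomainNorm 3 2 (cylinderCell L) volume v := by
  rw [eSobolevDomainNorm_eq_sum_iterDeriv 2 3 hv]
  have h1 : eLpNorm (iterDeriv k (fun j => Module.finBasis ℝ (EuclideanSpace ℝ (Fin 3)) (w j)) v) 2
        (volume.restrict (cylinderCell L : Set (EuclideanSpace ℝ (Fin 3)))) ≤
      ∑ w' : Fin k → Fin 𝔡, eLpNorm (iterDeriv k
        (fun j => Module.finBasis ℝ (EuclideanSpace ℝ (Fin 3)) (w' j)) v) 2
        (volume.restrict (cylinderCell L : Set (EuclideanSpace ℝ (Fin 3)))) :=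
    Finset.single_le_sum (f := fun w' : Fin k → Fin 𝔡 => eLpNorm (iterDeriv k
        (fun j => Module.finBasis ℝ (EuclideanSpace ℝ (Fin 3)) (w' j)) v) 2
        (volume.restrict (cylinderCell L : Set (EuclideanSpace ℝ (Fin 3)))))
      (fun _ _ => zero_le) (Finset.mem_univ w)
  refine h1.trans ?_
  exact Finset.single_le_sum (f := fun m => ∑ w' : Fin m → Fin 𝔡, eLpNorm (iterDeriv m
        (fun j => Module.finBasis ℝ (EuclideanSpace ℝ (Fin 3)) (w' j)) v) 2
        (volume.restrict (cylinderCell L : Set (EuclideanSpace ℝ (Fin 3)))))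
    (fun _ _ => zero_le) (Finset.mem_range.2 (by omega))

/-- Real form: `∫_cell ‖D_w v‖² ≤ (‖v‖_{H³(cell)})²` when the norm is finite (`MemLp` from the finite
norm and continuity on the open cell). [folklore] -/
theorem integral_norm_sq_iterDeriv_le
    (hv : ContDiffOn ℝ ∞ v (cylinderCell L : Set (EuclideanSpace ℝ (Fin 3)))) {N₃ : ℝ≥0∞} (hN₃ : N₃ ≠ ⊤)
    (hvN : eSobolevDomainNorm 3 2 (cylinderCell L) volume v ≤ N₃) {k : ℕ} (hk : k ≤ 3) (w : Fin k → Fin 𝔡) :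
    ∫ x in (cylinderCell L : Set (EuclideanSpace ℝ (Fin 3))),
        ‖iterDeriv k (fun j => Module.finBasis ℝ (EuclideanSpace ℝ (Fin 3)) (w j)) v x‖ ^ 2 ≤
      N₃.toReal ^ 2 := by
  set f := iterDeriv k (fun j => Module.finBasis ℝ (EuclideanSpace ℝ (Fin 3)) (w j)) v with hf
  have hle := (eLpNorm_iterDeriv_le_eSobolevDomainNorm hv hk w).trans hvN
  have hcont : ContinuousOn f (cylinderCell L : Set (EuclideanSpace ℝ (Fin 3))) :=
    (ContDiffOn.iterDeriv_of_isOpen (cylinderCell L).isOpen k _ hv).continuousOn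
  have hmem : MemLp f 2 (volume.restrict (cylinderCell L : Set (EuclideanSpace ℝ (Fin 3)))) :=
    ⟨hcont.aestronglyMeasurable (cylinderCell L).isOpen.measurableSet, hle.trans_lt hN₃.lt_top⟩
  rw [integral_norm_sq_eq_toReal_eLpNorm_two_sq hmem]
  exact pow_le_pow_left₀ ENNReal.toReal_nonneg
    ((ENNReal.toReal_le_toReal (hle.trans_lt hN₃.lt_top).ne hN₃).2 hle) 2

end Setting

/-! ### Term bounds -/

section TermBounds


variable {F' : Type*} [NormedAddCommGroup F'] [InnerProductSpace ℝ F']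
variable {L : ℝ}

/-- **Type I** (`(A·∇)B` with `A` bounded): `‖(A·∇) B‖_{L²(cell)} ≤ M C_b Σⱼ ‖∂ⱼ B‖_{L²(cell)}` if
`‖A‖ ≤ M` on the cell (`‖DB(x)(A x)‖ ≤ ‖DB(x)‖ ‖A x‖` and the operator norm is controlled by the
values on the basis, constant `C_b`). [folklore] -/
theorem eLpNorm_convect_le_of_norm_le {C_b : ℝ≥0}
    (hCb : ∀ T : EuclideanSpace ℝ (Fin 3) →L[ℝ] F', ‖T‖ ≤ C_b * ∑ j, ‖T (𝔢 j)‖)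
    {A : EuclideanSpace ℝ (Fin 3) → EuclideanSpace ℝ (Fin 3)} {B : EuclideanSpace ℝ (Fin 3) → F'}
    {M : ℝ} (hA : ∀ x ∈ (cylinderCell L : Set (EuclideanSpace ℝ (Fin 3))), ‖A x‖ ≤ M)
    (hB : ∀ j, ContinuousOn (fun x => fderiv ℝ B x (𝔢 j)) (cylinderCell L : Set (EuclideanSpace ℝ (Fin 3)))) :
    eLpNorm (convect A B) 2 (volume.restrict (cylinderCell L : Set (EuclideanSpace ℝ (Fin 3)))) ≤
      ENNReal.ofReal (M * C_b) * ∑ j, eLpNorm (fun x => fderiv ℝ B x (𝔢 j)) 2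
        (volume.restrict (cylinderCell L : Set (EuclideanSpace ℝ (Fin 3)))) := by
  set μ : Measure (EuclideanSpace ℝ (Fin 3)) := volume.restrict (cylinderCell L : Set _) with hμ
  have hpt : ∀ᵐ x ∂μ, ‖convect A B x‖ ≤ (M * C_b) * ‖∑ j, ‖fderiv ℝ B x (𝔢 j)‖‖ := by
    refine ae_restrict_of_forall_mem (cylinderCell L).isOpen.measurableSet fun x hx => ?_
    rw [convect_apply, Real.norm_of_nonneg (Finset.sum_nonneg fun j _ => norm_nonneg _)]
    calc ‖fderiv ℝ B x (A x)‖ ≤ ‖fderiv ℝ B x‖ * ‖A x‖ := ContinuousLinearMap.le_opNorm _ _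
      _ ≤ (C_b * ∑ j, ‖fderiv ℝ B x (𝔢 j)‖) * M :=
          mul_le_mul (hCb _) (hA x hx) (norm_nonneg _) (by positivity)
      _ = (M * C_b) * ∑ j, ‖fderiv ℝ B x (𝔢 j)‖ := by ring
  have hmeas : ∀ j, AEStronglyMeasurable (fun x => ‖fderiv ℝ B x (𝔢 j)‖) μ := fun j =>
    ((hB j).aestronglyMeasurable (cylinderCell L).isOpen.measurableSet).norm
  have e : (fun x => ∑ j, ‖fderiv ℝ B x (𝔢 j)‖) = ∑ j, fun x => ‖fderiv ℝ B x (𝔢 j)‖ := by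
    funext x; simp only [Finset.sum_apply]
  calc eLpNorm (convect A B) 2 μ ≤ ENNReal.ofReal (M * C_b) * eLpNorm (fun x => ∑ j, ‖fderiv ℝ B x (𝔢 j)‖) 2 μ :=
        eLpNorm_le_mul_eLpNorm_of_ae_le_mul hpt 2
    _ ≤ ENNReal.ofReal (M * C_b) * ∑ j, eLpNorm (fun x => ‖fderiv ℝ B x (𝔢 j)‖) 2 μ := by
        rw [e]; gcongr; exact eLpNorm_sum_le (fun j _ => hmeas j) one_le_two
    _ = ENNReal.ofReal (M * C_b) * ∑ j, eLpNorm (fun x => fderiv ℝ B x (𝔢 j)) 2 μ := by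
        simp_rw [eLpNorm_norm]

/-- **Type III** (`(A·∇)B` with `DB` bounded on the basis): `‖(A·∇) B‖_{L²(cell)} ≤ C_b 𝔡 M ‖A‖_{L²(cell)}`
if `‖∂ⱼ B‖ ≤ M` on the cell for all `j`. [folklore] -/
theorem eLpNorm_convect_le_of_fderiv_apply_le {C_b : ℝ≥0}
    (hCb : ∀ T : EuclideanSpace ℝ (Fin 3) →L[ℝ] F', ‖T‖ ≤ C_b * ∑ j, ‖T (𝔢 j)‖)
    {A : EuclideanSpace ℝ (Fin 3) → EuclideanSpace ℝ (Fin 3)} {B : EuclideanSpace ℝ (Fin 3) → F'}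
    {M : ℝ}
    (hB : ∀ x ∈ (cylinderCell L : Set (EuclideanSpace ℝ (Fin 3))), ∀ j, ‖fderiv ℝ B x (𝔢 j)‖ ≤ M) :
    eLpNorm (convect A B) 2 (volume.restrict (cylinderCell L : Set (EuclideanSpace ℝ (Fin 3)))) ≤
      ENNReal.ofReal (C_b * 𝔡 * M) * eLpNorm A 2
        (volume.restrict (cylinderCell L : Set (EuclideanSpace ℝ (Fin 3)))) := by
  refine eLpNorm_le_mul_eLpNorm_of_ae_le_mul ?_ 2
  refine ae_restrict_of_forall_mem (cylinderCell L).isOpen.measurableSet fun x hx => ?_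
  rw [convect_apply]
  have hsum : ∑ j, ‖fderiv ℝ B x (𝔢 j)‖ ≤ 𝔡 * M :=
    calc ∑ j, ‖fderiv ℝ B x (𝔢 j)‖ ≤ ∑ _j : Fin 𝔡, M := Finset.sum_le_sum fun j _ => hB x hx j
      _ = 𝔡 * M := by rw [Finset.sum_const, Finset.card_univ, Fintype.card_fin, nsmul_eq_mul]
  calc ‖fderiv ℝ B x (A x)‖ ≤ ‖fderiv ℝ B x‖ * ‖A x‖ := ContinuousLinearMap.le_opNorm _ _
    _ ≤ (C_b * (𝔡 * M)) * ‖A x‖ := by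
        refine mul_le_mul_of_nonneg_right ((hCb _).trans ?_) (norm_nonneg _)
        exact mul_le_mul_of_nonneg_left hsum C_b.coe_nonneg
    _ = (C_b * 𝔡 * M) * ‖A x‖ := by ring

end TermBounds

/-! ### Type II: the `L⁴ × L⁴` product via the Nirenberg inequality -/

section TypeTwo


/-- Index words of length one built by appending a letter to the empty word. [folklore] -/
def idxWord₁ (c : Fin 𝔡) : Fin 1 → Fin 𝔡 := Fin.snoc Fin.elim0 c
/-- Index words of length two built by appending letters. [folklore] -/
def idxWord₂ (c j : Fin 𝔡) : Fin 2 → Fin 𝔡 := Fin.snoc (idxWord₁ c) j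
/-- Index words of length three built by appending letters. [folklore] -/
def idxWord₃ (c j k : Fin 𝔡) : Fin 3 → Fin 𝔡 := Fin.snoc (idxWord₂ c j) k

variable {F' : Type*} [NormedAddCommGroup F'] [NormedSpace ℝ F']

/-- `D_{(c)} f = ∂_c f`. [folklore] -/
theorem iterDeriv_idxWord₁ (c : Fin 𝔡) (f : EuclideanSpace ℝ (Fin 3) → F') :
    iterDeriv 1 (fun i => 𝔢 (idxWord₁ c i)) f = fun x => fderiv ℝ f x (𝔢 c) := by
  rw [show (fun i => 𝔢 (idxWord₁ c i)) = Fin.snoc (fun i => 𝔢 ((Fin.elim0 : Fin 0 → Fin 𝔡) i)) (𝔢 c)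
    from (Fin.comp_snoc 𝔢 _ _), iterDeriv_snoc]
  rfl

/-- `D_{(c,j)} f = ∂ⱼ (∂_c f)`. [folklore] -/
theorem iterDeriv_idxWord₂ (c j : Fin 𝔡) (f : EuclideanSpace ℝ (Fin 3) → F') :
    iterDeriv 2 (fun i => 𝔢 (idxWord₂ c j i)) f =
      fun x => fderiv ℝ (fun y => fderiv ℝ f y (𝔢 c)) x (𝔢 j) := by
  rw [show (fun i => 𝔢 (idxWord₂ c j i)) = Fin.snoc (fun i => 𝔢 (idxWord₁ c i)) (𝔢 j)
    from (Fin.comp_snoc 𝔢 _ _), iterDeriv_snoc, iterDeriv_idxWord₁]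

/-- `D_{(c,j,k)} f = ∂ₖ (D_{(c,j)} f)`. [folklore] -/
theorem iterDeriv_idxWord₃ (c j k : Fin 𝔡) (f : EuclideanSpace ℝ (Fin 3) → F') :
    iterDeriv 3 (fun i => 𝔢 (idxWord₃ c j k i)) f =
      fun x => fderiv ℝ (iterDeriv 2 (fun i => 𝔢 (idxWord₂ c j i)) f) x (𝔢 k) := by
  rw [show (fun i => 𝔢 (idxWord₃ c j k i)) = Fin.snoc (fun i => 𝔢 (idxWord₂ c j i)) (𝔢 k)
    from (Fin.comp_snoc 𝔢 _ _), iterDeriv_snoc]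

variable {L : ℝ}

/-- **Type II** — the analytic heart of Ferrari's Lemma 1 (ii) at `s = 3`: on the period cell,
`‖(∂_b∂ₐv·∇) ∂_c v‖_{L²(cell)} ≤ K ‖∂v‖_∞ ‖v‖_{H³(cell)}` for `v` smooth on the closed cylinder and
`L`-periodic. With `f = ‖∂ⱼ∂_c v‖`, `g = ‖∂_b∂ₐv‖`: `‖(∂_b∂ₐv·∇)∂_c v‖ ≤ C_b Σⱼ f g`,
`∫ f²g² ≤ ‖f‖²_{L⁴} ‖g‖²_{L⁴}`, and the Nirenberg inequality `‖∂ⱼ∂_c v‖²_{L⁴} ≤ C ‖∂_c v‖_∞ ‖v‖_{H³}`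
(`exists_integral_norm_fderiv_pow_four_le'`, applied to the up-to-the-boundary realisation
`∂^K_c v` of `∂_c v`). Here `n` bounds `‖∂ⱼ v‖` on the cell for all `j` and `n₃²` bounds the
`L²(cell)` integrals of all word derivatives of length `≤ 3` in the basis. [cite: Ferrari1993, Lemma 1 (ii), p. 280 (the product estimate at s = 3)] -/
theorem exists_integral_norm_sq_convect_two_one_le (hL : 0 < L) :
    ∃ K : ℝ, 0 ≤ K ∧ ∀ (v : EuclideanSpace ℝ (Fin 3) → EuclideanSpace ℝ (Fin 3))
      (_ : ContDiffOn ℝ ∞ v (closure (unitCylinder : Set (EuclideanSpace ℝ (Fin 3)))))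
      (_ : IsAxiallyPeriodic L v) (n n₃ : ℝ) (_ : 0 ≤ n) (_ : 0 ≤ n₃)
      (_ : ∀ x ∈ (cylinderCell L : Set (EuclideanSpace ℝ (Fin 3))), ∀ j, ‖fderiv ℝ v x (𝔢 j)‖ ≤ n)
      (_ : ∀ (k : ℕ) (_ : k ≤ 3) (w : Fin k → Fin 𝔡),
        ∫ x in (cylinderCell L : Set (EuclideanSpace ℝ (Fin 3))),
          ‖iterDeriv k (fun i => 𝔢 (w i)) v x‖ ^ 2 ≤ n₃ ^ 2)
      (a b c : Fin 𝔡),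
      ∫ x in (cylinderCell L : Set (EuclideanSpace ℝ (Fin 3))),
          ‖convect (fun x => fderiv ℝ (fun y => fderiv ℝ v y (𝔢 a)) x (𝔢 b))
            (fun x => fderiv ℝ v x (𝔢 c)) x‖ ^ 2 ≤ (K * n * n₃) ^ 2 := by
  obtain ⟨C_b, -, hCb⟩ := exists_opNorm_le_mul_sum_basis (F := EuclideanSpace ℝ (Fin 3)) 𝔢
  obtain ⟨C_G, hCG0, hCG⟩ := exists_integral_norm_fderiv_pow_four_le' (F := EuclideanSpace ℝ (Fin 3))
  set Be : ℝ := ∑ j, ‖𝔢 j‖ with hBe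
  have hBe0 : 0 ≤ Be := Finset.sum_nonneg fun j _ => norm_nonneg _
  have hBej : ∀ j, ‖𝔢 j‖ ≤ Be := fun j =>
    Finset.single_le_sum (f := fun j => ‖𝔢 j‖) (fun _ _ => norm_nonneg _) (Finset.mem_univ j)
  set d : ℝ := (𝔡 : ℝ) with hd
  have hd0 : 0 ≤ d := Nat.cast_nonneg _
  set K₁ : ℝ := Real.sqrt (C_G * (1 + (C_b : ℝ) ^ 2 * d ^ 2)) * Be with hK₁
  have hK₁0 : 0 ≤ K₁ := by positivity
  refine ⟨C_b * d * K₁, by positivity, fun v hv hper n n₃ hn hn₃ hsup hword a b c => ?_⟩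
  -- the setting
  set Kc : Set (EuclideanSpace ℝ (Fin 3)) := closure (unitCylinder : Set (EuclideanSpace ℝ (Fin 3)))
    with hKc
  set Ω : Set (EuclideanSpace ℝ (Fin 3)) := (cylinderCell L : Set (EuclideanSpace ℝ (Fin 3))) with hΩ
  have hKu : UniqueDiffOn ℝ Kc := uniqueDiffOn_closure_unitCylinder
  have hU : IsOpen (unitCylinder : Set (EuclideanSpace ℝ (Fin 3))) := unitCylinder.isOpen
  have hUK : ∀ x ∈ (unitCylinder : Set (EuclideanSpace ℝ (Fin 3))), Kc ∈ 𝓝 x := fun x hx =>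
    closure_unitCylinder_mem_nhds hx
  have hΩU : Ω ⊆ (unitCylinder : Set (EuclideanSpace ℝ (Fin 3))) := cylinderCell_le_unitCylinder L
  have hΩm : MeasurableSet Ω := (cylinderCell L).isOpen.measurableSet
  -- realisations of the word derivatives up to the boundary
  set R : (k : ℕ) → (Fin k → Fin 𝔡) → (EuclideanSpace ℝ (Fin 3) → EuclideanSpace ℝ (Fin 3)) :=
    fun k w => iterDerivWithin Kc k (fun i => 𝔢 (w i)) v with hR
  have hRs : ∀ k w, ContDiffOn ℝ ∞ (R k w) Kc := fun k w => contDiffOn_iterDerivWithin hKu k _ hv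
  have hRc : ∀ k w, ContinuousOn (R k w) Kc := fun k w => (hRs k w).continuousOn
  have hRper : ∀ k w, IsAxiallyPeriodic L (R k w) := fun k w => isAxiallyPeriodic_iterDerivWithin k _ hper
  have hReq : ∀ k w, EqOn (R k w) (iterDeriv k (fun i => 𝔢 (w i)) v) (unitCylinder : Set _) :=
    fun k w => iterDerivWithin_eqOn_iterDeriv hKu hU hUK k _ hv
  have hReqΩ : ∀ k w x, x ∈ Ω → R k w x = iterDeriv k (fun i => 𝔢 (w i)) v x := fun k w x hx =>
    hReq k w (hΩU hx)
  -- `∂_c v` realised: bounded by `n` on the closed cylinder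
  have hR1 : ∀ c', EqOn (R 1 (idxWord₁ c')) (fun x => fderiv ℝ v x (𝔢 c')) (unitCylinder : Set _) := by
    intro c' x hx
    rw [hReq 1 _ hx, iterDeriv_idxWord₁]
  have hR1bd : ∀ c', ∀ x ∈ Kc, ‖R 1 (idxWord₁ c') x‖ ≤ n := fun c' =>
    norm_le_of_forall_mem_cylinderCell hL (hRc 1 _) (hRper 1 _) fun x hx => by
      rw [hR1 c' (hΩU hx)]; exact hsup x hx c'
  -- `∂ⱼ` of the realised `∂_c v` is `D_{(c,j)} v` in the cell, and its derivative is controlled by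
  -- the words of length three
  have hD1 : ∀ c' j, ∀ x ∈ Ω, fderiv ℝ (R 1 (idxWord₁ c')) x (𝔢 j) =
      iterDeriv 2 (fun i => 𝔢 (idxWord₂ c' j i)) v x := by
    intro c' j x hx
    have h : R 1 (idxWord₁ c') =ᶠ[𝓝 x] fun y => fderiv ℝ v y (𝔢 c') :=
      eventuallyEq_of_mem (hU.mem_nhds (hΩU hx)) (hR1 c')
    rw [h.fderiv_eq, iterDeriv_idxWord₂]
  have hD2 : ∀ c' j, ∀ x ∈ Ω, fderiv ℝ (fun y => fderiv ℝ (R 1 (idxWord₁ c')) y (𝔢 j)) x =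
      fderiv ℝ (iterDeriv 2 (fun i => 𝔢 (idxWord₂ c' j i)) v) x := by
    intro c' j x hx
    refine Filter.EventuallyEq.fderiv_eq ?_
    filter_upwards [hU.mem_nhds (hΩU hx)] with y hy
    have h : R 1 (idxWord₁ c') =ᶠ[𝓝 y] fun z => fderiv ℝ v z (𝔢 c') :=
      eventuallyEq_of_mem (hU.mem_nhds hy) (hR1 c')
    rw [h.fderiv_eq, iterDeriv_idxWord₂]
  have hD2' : ∀ c' j, ∀ x ∈ Ω, fderiv ℝ (iterDeriv 2 (fun i => 𝔢 (idxWord₂ c' j i)) v) x =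
      fderiv ℝ (R 2 (idxWord₂ c' j)) x := by
    intro c' j x hx
    refine Filter.EventuallyEq.fderiv_eq ?_
    exact (eventuallyEq_of_mem (hU.mem_nhds (hΩU hx)) (hReq 2 (idxWord₂ c' j))).symm
  have hD3 : ∀ c' j k, ∀ x ∈ Ω, fderiv ℝ (R 2 (idxWord₂ c' j)) x (𝔢 k) = R 3 (idxWord₃ c' j k) x := by
    intro c' j k x hx
    rw [← hD2' c' j x hx, hReqΩ 3 _ x hx, iterDeriv_idxWord₃]
  -- Step 1: `∫ ‖∂ⱼ ∂^K_c v‖⁴ ≤ (K₁ n n₃)²` for all `c, j`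
  have hfour : ∀ c' j, ∫ x in Ω, ‖R 2 (idxWord₂ c' j) x‖ ^ 4 ≤ (K₁ * n * n₃) ^ 2 := by
    intro c' j
    set g := R 1 (idxWord₁ c') with hg
    have hg2 : ContDiffOn ℝ 2 g Kc := (hRs 1 _).of_le (WithTop.coe_le_coe.mpr le_top)
    have hGN := hCG L hL g hg2 (hRper 1 _) n (hR1bd c') (𝔢 j)
    -- rewrite the integrands of the Nirenberg inequality on the cell
    have eL : ∫ x in Ω, ‖fderiv ℝ g x (𝔢 j)‖ ^ 4 = ∫ x in Ω, ‖R 2 (idxWord₂ c' j) x‖ ^ 4 :=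
      setIntegral_congr_fun hΩm fun x hx => by rw [hD1 c' j x hx, hReqΩ 2 _ x hx]
    have eR1 : ∫ x in Ω, (‖fderiv ℝ g x (𝔢 j)‖ ^ 2 + ‖fderiv ℝ (fun y => fderiv ℝ g y (𝔢 j)) x‖ ^ 2) =
        ∫ x in Ω, (‖R 2 (idxWord₂ c' j) x‖ ^ 2 + ‖fderiv ℝ (R 2 (idxWord₂ c' j)) x‖ ^ 2) :=
      setIntegral_congr_fun hΩm fun x hx => by
        rw [hD1 c' j x hx, hReqΩ 2 _ x hx, hD2 c' j x hx, hD2' c' j x hx]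
    rw [eL, eR1] at hGN
    -- bound the right-hand side
    have hint2 : IntegrableOn (fun x => ‖R 2 (idxWord₂ c' j) x‖ ^ 2) Ω volume :=
      integrableOn_cylinderCell_of_continuousOn_closure L ((hRc 2 _).norm.pow 2)
    have hDK : ∀ x ∈ Ω, fderiv ℝ (R 2 (idxWord₂ c' j)) x = fderivWithin ℝ (R 2 (idxWord₂ c' j)) Kc x :=
      fun x hx => (fderivWithin_of_mem_nhds (hUK x (hΩU hx))).symm
    have cDK : ContinuousOn (fun x => fderivWithin ℝ (R 2 (idxWord₂ c' j)) Kc x) Kc :=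
      (hRs 2 _).continuousOn_fderivWithin hKu (by exact_mod_cast le_top)
    have hintD : IntegrableOn (fun x => ‖fderiv ℝ (R 2 (idxWord₂ c' j)) x‖ ^ 2) Ω volume :=
      (integrableOn_cylinderCell_of_continuousOn_closure L (cDK.norm.pow 2)).congr_fun
        (fun x hx => by simp only [Pi.pow_apply, hDK x hx]) hΩm
    have hint3 : ∀ k, IntegrableOn (fun x => ‖R 3 (idxWord₃ c' j k) x‖ ^ 2) Ω volume := fun k =>
      integrableOn_cylinderCell_of_continuousOn_closure L ((hRc 3 _).norm.pow 2)
    have hA2 : ∫ x in Ω, ‖R 2 (idxWord₂ c' j) x‖ ^ 2 ≤ n₃ ^ 2 := by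
      have h := hword 2 (by norm_num) (idxWord₂ c' j)
      rwa [setIntegral_congr_fun hΩm (fun x hx => by rw [← hReqΩ 2 (idxWord₂ c' j) x hx])] at h
    have hA3 : ∀ k, ∫ x in Ω, ‖R 3 (idxWord₃ c' j k) x‖ ^ 2 ≤ n₃ ^ 2 := by
      intro k
      have h := hword 3 le_rfl (idxWord₃ c' j k)
      rwa [setIntegral_congr_fun hΩm (fun x hx => by rw [← hReqΩ 3 (idxWord₃ c' j k) x hx])] at h
    have hDpt : ∀ x ∈ Ω, ‖fderiv ℝ (R 2 (idxWord₂ c' j)) x‖ ^ 2 ≤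
        (C_b : ℝ) ^ 2 * (d * ∑ k, ‖R 3 (idxWord₃ c' j k) x‖ ^ 2) := by
      intro x hx
      have h1 : ‖fderiv ℝ (R 2 (idxWord₂ c' j)) x‖ ≤ C_b * ∑ k, ‖R 3 (idxWord₃ c' j k) x‖ := by
        refine (hCb _).trans (le_of_eq ?_)
        congr 1
        exact Finset.sum_congr rfl fun k _ => by rw [hD3 c' j k x hx]
      have h2 : (∑ k, ‖R 3 (idxWord₃ c' j k) x‖) ^ 2 ≤ d * ∑ k, ‖R 3 (idxWord₃ c' j k) x‖ ^ 2 := by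
        have := sq_sum_le_card_mul_sum_sq (s := Finset.univ) (f := fun k => ‖R 3 (idxWord₃ c' j k) x‖)
        rwa [Finset.card_univ, Fintype.card_fin] at this
      calc ‖fderiv ℝ (R 2 (idxWord₂ c' j)) x‖ ^ 2 ≤ (C_b * ∑ k, ‖R 3 (idxWord₃ c' j k) x‖) ^ 2 :=
            pow_le_pow_left₀ (norm_nonneg _) h1 2
        _ = (C_b : ℝ) ^ 2 * (∑ k, ‖R 3 (idxWord₃ c' j k) x‖) ^ 2 := by ring
        _ ≤ (C_b : ℝ) ^ 2 * (d * ∑ k, ‖R 3 (idxWord₃ c' j k) x‖ ^ 2) :=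
            mul_le_mul_of_nonneg_left h2 (sq_nonneg _)
    have hDint : ∫ x in Ω, ‖fderiv ℝ (R 2 (idxWord₂ c' j)) x‖ ^ 2 ≤ (C_b : ℝ) ^ 2 * (d * (d * n₃ ^ 2)) := by
      calc ∫ x in Ω, ‖fderiv ℝ (R 2 (idxWord₂ c' j)) x‖ ^ 2
          ≤ ∫ x in Ω, (C_b : ℝ) ^ 2 * (d * ∑ k, ‖R 3 (idxWord₃ c' j k) x‖ ^ 2) :=
            setIntegral_mono_on hintD ((integrable_finsetSum _ fun k _ => hint3 k).const_mul d
              |>.const_mul _) hΩm hDpt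
        _ = (C_b : ℝ) ^ 2 * (d * ∑ k, ∫ x in Ω, ‖R 3 (idxWord₃ c' j k) x‖ ^ 2) := by
            rw [integral_const_mul, integral_const_mul, integral_finsetSum _ fun k _ => hint3 k]
        _ ≤ (C_b : ℝ) ^ 2 * (d * ∑ _k : Fin 𝔡, n₃ ^ 2) := by
            gcongr with k
            exact hA3 k
        _ = (C_b : ℝ) ^ 2 * (d * (d * n₃ ^ 2)) := by
            rw [Finset.sum_const, Finset.card_univ, Fintype.card_fin, nsmul_eq_mul]
    have hsum : ∫ x in Ω, (‖R 2 (idxWord₂ c' j) x‖ ^ 2 + ‖fderiv ℝ (R 2 (idxWord₂ c' j)) x‖ ^ 2) ≤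
        (1 + (C_b : ℝ) ^ 2 * d ^ 2) * n₃ ^ 2 := by
      rw [integral_add hint2 hintD]
      nlinarith [hA2, hDint]
    have hI0 : 0 ≤ ∫ x in Ω, (‖R 2 (idxWord₂ c' j) x‖ ^ 2 + ‖fderiv ℝ (R 2 (idxWord₂ c' j)) x‖ ^ 2) :=
      setIntegral_nonneg hΩm fun x _ => by positivity
    have hE2 : ‖𝔢 j‖ ^ 2 ≤ Be ^ 2 := pow_le_pow_left₀ (norm_nonneg _) (hBej j) 2
    calc ∫ x in Ω, ‖R 2 (idxWord₂ c' j) x‖ ^ 4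
        ≤ C_G * n ^ 2 * ‖𝔢 j‖ ^ 2 *
            ∫ x in Ω, (‖R 2 (idxWord₂ c' j) x‖ ^ 2 + ‖fderiv ℝ (R 2 (idxWord₂ c' j)) x‖ ^ 2) := hGN
      _ ≤ C_G * n ^ 2 * Be ^ 2 *
            ∫ x in Ω, (‖R 2 (idxWord₂ c' j) x‖ ^ 2 + ‖fderiv ℝ (R 2 (idxWord₂ c' j)) x‖ ^ 2) :=
          mul_le_mul_of_nonneg_right (mul_le_mul_of_nonneg_left hE2 (by positivity)) hI0
      _ ≤ C_G * n ^ 2 * Be ^ 2 * ((1 + (C_b : ℝ) ^ 2 * d ^ 2) * n₃ ^ 2) :=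
          mul_le_mul_of_nonneg_left hsum (by positivity)
      _ = (K₁ * n * n₃) ^ 2 := by
          rw [hK₁, mul_pow, mul_pow, mul_pow, Real.sq_sqrt (by positivity)]
          ring
  -- Step 2: the product
  set A := fun x => fderiv ℝ (fun y => fderiv ℝ v y (𝔢 a)) x (𝔢 b) with hA_def
  set B := fun x => fderiv ℝ v x (𝔢 c) with hB_def
  have hAeq : ∀ x ∈ Ω, A x = R 2 (idxWord₂ a b) x := fun x hx => by
    rw [hReqΩ 2 _ x hx, iterDeriv_idxWord₂]
  have hBj : ∀ j, ∀ x ∈ Ω, fderiv ℝ B x (𝔢 j) = R 2 (idxWord₂ c j) x := fun j x hx => by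
    have h : B =ᶠ[𝓝 x] R 1 (idxWord₁ c) :=
      (eventuallyEq_of_mem (hU.mem_nhds (hΩU hx)) (hR1 c)).symm
    rw [h.fderiv_eq, hD1 c j x hx, hReqΩ 2 _ x hx]
  -- pointwise domination
  have hpt : ∀ x ∈ Ω, ‖convect A B x‖ ^ 2 ≤
      (C_b : ℝ) ^ 2 * (d * ∑ j, ‖R 2 (idxWord₂ c j) x‖ ^ 2 * ‖R 2 (idxWord₂ a b) x‖ ^ 2) := by
    intro x hx
    rw [convect_apply]
    have h1 : ‖fderiv ℝ B x (A x)‖ ≤ C_b * (∑ j, ‖R 2 (idxWord₂ c j) x‖) * ‖R 2 (idxWord₂ a b) x‖ := by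
      calc ‖fderiv ℝ B x (A x)‖ ≤ ‖fderiv ℝ B x‖ * ‖A x‖ := ContinuousLinearMap.le_opNorm _ _
        _ ≤ (C_b * ∑ j, ‖fderiv ℝ B x (𝔢 j)‖) * ‖A x‖ :=
            mul_le_mul_of_nonneg_right (hCb _) (norm_nonneg _)
        _ = C_b * (∑ j, ‖R 2 (idxWord₂ c j) x‖) * ‖R 2 (idxWord₂ a b) x‖ := by
            rw [hAeq x hx]
            congr 2
            exact Finset.sum_congr rfl fun j _ => by rw [hBj j x hx]
    have h2 : (∑ j, ‖R 2 (idxWord₂ c j) x‖) ^ 2 ≤ d * ∑ j, ‖R 2 (idxWord₂ c j) x‖ ^ 2 := by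
      have := sq_sum_le_card_mul_sum_sq (s := Finset.univ) (f := fun j => ‖R 2 (idxWord₂ c j) x‖)
      rwa [Finset.card_univ, Fintype.card_fin] at this
    calc ‖fderiv ℝ B x (A x)‖ ^ 2
        ≤ (C_b * (∑ j, ‖R 2 (idxWord₂ c j) x‖) * ‖R 2 (idxWord₂ a b) x‖) ^ 2 :=
          pow_le_pow_left₀ (norm_nonneg _) h1 2
      _ = (C_b : ℝ) ^ 2 * ((∑ j, ‖R 2 (idxWord₂ c j) x‖) ^ 2 * ‖R 2 (idxWord₂ a b) x‖ ^ 2) := by ring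
      _ ≤ (C_b : ℝ) ^ 2 * ((d * ∑ j, ‖R 2 (idxWord₂ c j) x‖ ^ 2) * ‖R 2 (idxWord₂ a b) x‖ ^ 2) := by
          gcongr
      _ = (C_b : ℝ) ^ 2 * (d * ((∑ j, ‖R 2 (idxWord₂ c j) x‖ ^ 2) * ‖R 2 (idxWord₂ a b) x‖ ^ 2)) := by
          ring
      _ = (C_b : ℝ) ^ 2 * (d * ∑ j, ‖R 2 (idxWord₂ c j) x‖ ^ 2 * ‖R 2 (idxWord₂ a b) x‖ ^ 2) := by
          rw [Finset.sum_mul]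
  -- integrate
  have hintP : ∀ j, IntegrableOn (fun x => ‖R 2 (idxWord₂ c j) x‖ ^ 2 * ‖R 2 (idxWord₂ a b) x‖ ^ 2) Ω volume :=
    fun j => integrableOn_cylinderCell_of_continuousOn_closure L
      (((hRc 2 _).norm.pow 2).mul ((hRc 2 _).norm.pow 2))
  have hintR : IntegrableOn
      (fun x => (C_b : ℝ) ^ 2 * (d * ∑ j, ‖R 2 (idxWord₂ c j) x‖ ^ 2 * ‖R 2 (idxWord₂ a b) x‖ ^ 2)) Ω volume :=
    ((integrable_finsetSum _ fun j _ => hintP j).const_mul d).const_mul _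
  have hCS : ∀ j, ∫ x in Ω, ‖R 2 (idxWord₂ c j) x‖ ^ 2 * ‖R 2 (idxWord₂ a b) x‖ ^ 2 ≤ (K₁ * n * n₃) ^ 2 := by
    intro j
    have h := setIntegral_sq_mul_le_sqrt_mul_sqrt L (hRc 2 (idxWord₂ c j)).norm
      ((hRc 2 (idxWord₂ a b)).norm.pow 2) fun x => sq_nonneg _
    have hK0 : 0 ≤ K₁ * n * n₃ := by positivity
    have h4 : ∫ x in Ω, ((fun x => ‖R 2 (idxWord₂ a b) x‖ ^ 2) x) ^ 2 ≤ (K₁ * n * n₃) ^ 2 :=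
      (integral_congr_ae (Eventually.of_forall fun x => by beta_reduce; ring)).trans_le (hfour a b)
    refine h.trans ?_
    calc Real.sqrt (∫ x in Ω, ‖R 2 (idxWord₂ c j) x‖ ^ 4) *
          Real.sqrt (∫ x in Ω, ((fun x => ‖R 2 (idxWord₂ a b) x‖ ^ 2) x) ^ 2)
        ≤ Real.sqrt ((K₁ * n * n₃) ^ 2) * Real.sqrt ((K₁ * n * n₃) ^ 2) :=
          mul_le_mul (Real.sqrt_le_sqrt (hfour c j)) (Real.sqrt_le_sqrt h4)
            (Real.sqrt_nonneg _) (Real.sqrt_nonneg _)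
      _ = (K₁ * n * n₃) ^ 2 := by rw [Real.sqrt_sq hK0]; ring
  calc ∫ x in Ω, ‖convect A B x‖ ^ 2
      ≤ ∫ x in Ω, (C_b : ℝ) ^ 2 * (d * ∑ j, ‖R 2 (idxWord₂ c j) x‖ ^ 2 * ‖R 2 (idxWord₂ a b) x‖ ^ 2) := by
        refine integral_mono_of_nonneg (Eventually.of_forall fun x => sq_nonneg _) hintR ?_
        exact ae_restrict_of_forall_mem hΩm hpt
    _ = (C_b : ℝ) ^ 2 * (d * ∑ j, ∫ x in Ω, ‖R 2 (idxWord₂ c j) x‖ ^ 2 * ‖R 2 (idxWord₂ a b) x‖ ^ 2) := by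
        rw [integral_const_mul, integral_const_mul, integral_finsetSum _ fun j _ => hintP j]
    _ ≤ (C_b : ℝ) ^ 2 * (d * ∑ _j : Fin 𝔡, (K₁ * n * n₃) ^ 2) := by
        gcongr with j
        exact hCS j
    _ = (C_b * d * K₁ * n * n₃) ^ 2 := by
        rw [Finset.sum_const, Finset.card_univ, Fintype.card_fin, nsmul_eq_mul]
        ring

end TypeTwo

end Literature.Analysis.FluidPDE
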